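import Summits.CriticalPhenomena.PercolationContinuityZ3.Theorems.Transplant.SkelPhiCorridorKitsFHab
import Summits.CriticalPhenomena.PercolationContinuityZ3.Theorems.Transplant.SkelPhiParaCorridorKGRead
import HarnessLib

/-!
# N2 (frames-only node `SamePDropOfSkeletonFrm₁`, OPEN), (C) column: **THE PER-CENTRE INPUTS OF THE THREE K-G CORRIDOR PHASES** — the `hroute`
# hypothesis of `Skelφ.hkits_levelF` (SkelPhiCorridorKitsF) for a level of the widened E-run, of the along-parking and of the across-parking
# (SkelPhiParaCorridorKGRead's schedules `xRunSchedB`, `xParkSchedC`, `yParkSchedC` in the ONE frame `runX φ c₀ n h σ`), from the LONG LINKS at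
# every centre at accuracy `δ³`: a striding centre gets the route datum (`routeSetsW` on the link / landing readings), a FAR centre of a parking
# phase is PARKED — its frame image already lies in the next core (`ParkPrm.box_subset_of_isFar` at offset `0`), so `c ∈ Win(core (k+1)) ⊆ T`.

builds on p205010 (kernel theorem, internal audit signed; external expert review pending) — nothing in this file uses p205010; nothing here is a
claim about the open node `SamePDropOfSkeletonFrm₁`.
Lane `prim-bschramm`, seat `prim-bschramm-p5` (gen 15; (C) lineage; (R-22) K-G); helper file (`--supports stmt-CriticalPhenomena-4575 --as helper`).
* `hroute_runB` / `hroute_runBIn` (E-run level; plain / habitat law), `xParkC_self_mem_core_succ_of_far`, `hroute_xParkC` / `hroute_xParkCIn`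
  (along-parking level), `yParkC_self_mem_core_succ_of_far`, `hroute_yParkC` / `hroute_yParkCIn` (across-parking level; top pieces `pgTopPieceW … σ τ v`).
[cite: KozmaNitzan2024, §4 Lemma 10 Step IV (pp. 20–21), Lemma 11 (pp. 22–23), Lemma 12 (pp. 23–25)] [cite: MartineauTassion2017, §4.3 Lemma 4.2]
-/

noncomputable section

open scoped Classical

namespace Summit.CriticalPhenomena.PercolationContinuityZ3.Theorems.Transplant

namespace Skelφ

open MeasureTheory
open Literature.Probability.Percolation Literature.Probability.LatticeModels SimpleGraph KNLevels
open Literature.Barriers.CriticalPhenomena (graphBall graphBall_mono)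
open Skel (winGraph winGraph_le winGraphIn winGraphIn_le)
open ChainPlanar ChainPara

variable {V : Type} [DecidableEq V] [Countable V] {G : SimpleGraph V} [G.LocallyFinite] {φ : V → Site 2}

/-! ## §1 The E-run phase: every centre strides -/

/-- **Per-centre input, E-run level**: from the long x-links at every centre (both transverse signs) at accuracy `δ³`, every centre of the
`R′`-enlarged core `k` of `xRunSchedB` inside `B(w₀, R − r)` carries a route datum into `T ⊇ Win(core (k+1))` through `Dr ⊇ Win(region k)`.
[cite: KozmaNitzan2024, §4 Lemma 10 Step IV, Lemma 11] [cite: MartineauTassion2017, §4.3 Lemma 4.2] -/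
theorem hroute_runB {n ℓ : ℕ} {h : ℤ} {R' qq W N : ℕ} (hn : 1 ≤ n) (c₀ : V) {σ : ℤ} (hσ : σ = 1 ∨ σ = -1) {k : ℕ} {w₀ : V} {R r Rl : ℕ}
    (hr : Rl ≤ r) (hrR : r ≤ R) {Dr T : Finset V}
    (hPD : Win G (runX φ c₀ n h σ) w₀ ((xRunSchedB n ℓ h R' qq W N).region k) R ⊆ Dr)
    (hPT : Win G (runX φ c₀ n h σ) w₀ ((xRunSchedB n ℓ h R' qq W N).core (k + 1)) R ⊆ T)
    {q : unitInterval} {Wt : Sym2 V → unitInterval} (hWD : IsSubbox (winGraph G w₀ R) Wt q Dr) (Λc : V → ℕ → Finset V) (kz : ℕ) {δ : ℝ}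
    (hlong : ∀ c (τ : ℤ), τ = 1 ∨ τ = -1 → 1 - δ ^ 3 < (bondPercolation G q).real
      (linkIn (pgramPrism G φ c n h (3 * ℓ) Rl) (Λc c kz) (pgSideHalfW G φ c n h ℓ Rl σ (σ * τ)))) :
    ∀ c : V, runX φ c₀ n h σ c ∈ Finset.Icc ((xRunSchedB n ℓ h R' qq W N).lo k - (((xRunSchedB n ℓ h R' qq W N).R' : ℕ) : Site 2))
        ((xRunSchedB n ℓ h R' qq W N).hi k + (((xRunSchedB n ℓ h R' qq W N).R' : ℕ) : Site 2)) → c ∈ graphBall G w₀ (R - r) →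
      c ∈ T ∨ ∃ Qt Ft : Finset V, Ft ⊆ T ∧ Qt ⊆ Dr ∧ 1 - δ ^ 3 ≤ (prodBernoulli Wt).real (linkIn (↑Qt : Set V) (Λc c kz) Ft) := by
  intro c hcI hcw
  refine Or.inr ?_
  obtain ⟨Qt, Ft, hFT, hQD, hlt⟩ := routeSetsW (ψ := runX φ c₀ n h σ) h ℓ hcw hr hrR (coe_pgSideHalfW_subset (G := G) (φ := φ) c n h ℓ Rl σ _)
    (fun w hw => runB_mem_region_of_link hn c₀ hσ hcI hw) (fun w hw => runB_mem_core_succ_of_piece hn c₀ hσ hcI hw) hPD hPT hWD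
    (hlong c _ ((xRunPrmB n ℓ h R' qq W N).steer_eq_or k _))
  exact ⟨Qt, Ft, hFT, hQD, hlt.le⟩

/-- (Habitat law.) **Per-centre input, E-run level**: from the long x-links at every centre (both transverse signs) at accuracy `δ³`, every centre of the
`R′`-enlarged core `k` of `xRunSchedB` inside `B(w₀, R − r)` carries a route datum into `T ⊇ Win(core (k+1))` through `Dr ⊇ Win(region k)`.
[cite: KozmaNitzan2024, §4 Lemma 10 Step IV, Lemma 11] [cite: MartineauTassion2017, §4.3 Lemma 4.2] -/
theorem hroute_runBIn {n ℓ : ℕ} {h : ℤ} {R' qq W N : ℕ} (hn : 1 ≤ n) (c₀ : V) {σ : ℤ} (hσ : σ = 1 ∨ σ = -1) {k : ℕ} {w₀ : V} {R r Rl : ℕ}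
    (hr : Rl ≤ r) (hrR : r ≤ R) {Dr T : Finset V}
    (hPD : Win G (runX φ c₀ n h σ) w₀ ((xRunSchedB n ℓ h R' qq W N).region k) R ⊆ Dr)
    (hPT : Win G (runX φ c₀ n h σ) w₀ ((xRunSchedB n ℓ h R' qq W N).core (k + 1)) R ⊆ T)
    {Ω : Finset V} (hDrΩ : Dr ⊆ Ω) {q : unitInterval} {Wt : Sym2 V → unitInterval} (hWD : IsSubbox (winGraphIn G Ω) Wt q Dr) (Λc : V → ℕ → Finset V) (kz : ℕ) {δ : ℝ}
    (hlong : ∀ c (τ : ℤ), τ = 1 ∨ τ = -1 → 1 - δ ^ 3 < (bondPercolation G q).real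
      (linkIn (pgramPrism G φ c n h (3 * ℓ) Rl) (Λc c kz) (pgSideHalfW G φ c n h ℓ Rl σ (σ * τ)))) :
    ∀ c : V, runX φ c₀ n h σ c ∈ Finset.Icc ((xRunSchedB n ℓ h R' qq W N).lo k - (((xRunSchedB n ℓ h R' qq W N).R' : ℕ) : Site 2))
        ((xRunSchedB n ℓ h R' qq W N).hi k + (((xRunSchedB n ℓ h R' qq W N).R' : ℕ) : Site 2)) → c ∈ graphBall G w₀ (R - r) →
      c ∈ T ∨ ∃ Qt Ft : Finset V, Ft ⊆ T ∧ Qt ⊆ Dr ∧ 1 - δ ^ 3 ≤ (prodBernoulli Wt).real (linkIn (↑Qt : Set V) (Λc c kz) Ft) := by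
  intro c hcI hcw
  refine Or.inr ?_
  obtain ⟨Qt, Ft, hFT, hQD, hlt⟩ := routeSetsWIn (ψ := runX φ c₀ n h σ) h ℓ hcw hr hrR (coe_pgSideHalfW_subset (G := G) (φ := φ) c n h ℓ Rl σ _)
    (fun w hw => runB_mem_region_of_link hn c₀ hσ hcI hw) (fun w hw => runB_mem_core_succ_of_piece hn c₀ hσ hcI hw) hPD hPT hDrΩ hWD
    (hlong c _ ((xRunPrmB n ℓ h R' qq W N).steer_eq_or k _))
  exact ⟨Qt, Ft, hFT, hQD, hlt.le⟩

/-! ## §2 The along-parking phase: far centres park, the others stride -/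

section XParkC

variable {n ℓ : ℕ} {h : ℤ} {R' ρ : ℕ} {aLo0 A : ℤ} {Wm Wp N : ℕ} (hP : ParkOK (xParkPrmW n ℓ h R' ρ aLo0 A Wm Wp N)) (cc : Site 2)

/-- **A far centre's own frame image lies in the next core** (along-parking; `ParkPrm.box_subset_of_isFar` at offset `0`). [cite: KozmaNitzan2024, §4 Lemma 12] -/
theorem xParkC_self_mem_core_succ_of_far {k : ℕ} {y : Site 2}
    (hy : y ∈ Finset.Icc ((xParkSchedC hP cc).lo k - (((xParkSchedC hP cc).R' : ℕ) : Site 2)) ((xParkSchedC hP cc).hi k + (((xParkSchedC hP cc).R' : ℕ) : Site 2)))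
    (hfar : (xParkPrmW n ℓ h R' ρ aLo0 A Wm Wp N).IsFar k (y 0 - cc 0)) : y ∈ (xParkSchedC hP cc).core (k + 1) := by
  have hy' := (mem_xParkC_enl_iff hP cc).1 hy
  refine (mem_xParkC_core_iff hP cc).2 (ParkPrm.box_subset_of_isFar hy' hfar ?_ ?_) <;> simp

/-- **Per-centre input, along-parking level**: a FAR centre is parked (`c ∈ T`), a striding centre carries the route datum from the long x-link of
its steered side half. [cite: KozmaNitzan2024, §4 Lemma 10 Step IV, Lemma 12 (pp. 23–25)] [cite: MartineauTassion2017, §4.3 Lemma 4.2] -/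
theorem hroute_xParkC (hn : 1 ≤ n) (c₀ : V) {σ : ℤ} (hσ : σ = 1 ∨ σ = -1) {k : ℕ} {w₀ : V} {R r Rl : ℕ} (hr : Rl ≤ r) (hrR : r ≤ R)
    {Dr T : Finset V} (hPD : Win G (runX φ c₀ n h σ) w₀ ((xParkSchedC hP cc).region k) R ⊆ Dr)
    (hPT : Win G (runX φ c₀ n h σ) w₀ ((xParkSchedC hP cc).core (k + 1)) R ⊆ T)
    {q : unitInterval} {Wt : Sym2 V → unitInterval} (hWD : IsSubbox (winGraph G w₀ R) Wt q Dr) (Λc : V → ℕ → Finset V) (kz : ℕ) {δ : ℝ}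
    (hlong : ∀ c (τ : ℤ), τ = 1 ∨ τ = -1 → 1 - δ ^ 3 < (bondPercolation G q).real
      (linkIn (pgramPrism G φ c n h (3 * ℓ) Rl) (Λc c kz) (pgSideHalfW G φ c n h ℓ Rl σ (σ * τ)))) :
    ∀ c : V, runX φ c₀ n h σ c ∈ Finset.Icc ((xParkSchedC hP cc).lo k - (((xParkSchedC hP cc).R' : ℕ) : Site 2))
        ((xParkSchedC hP cc).hi k + (((xParkSchedC hP cc).R' : ℕ) : Site 2)) → c ∈ graphBall G w₀ (R - r) →
      c ∈ T ∨ ∃ Qt Ft : Finset V, Ft ⊆ T ∧ Qt ⊆ Dr ∧ 1 - δ ^ 3 ≤ (prodBernoulli Wt).real (linkIn (↑Qt : Set V) (Λc c kz) Ft) := by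
  intro c hcI hcw
  by_cases hfar : (xParkPrmW n ℓ h R' ρ aLo0 A Wm Wp N).IsFar k (runX φ c₀ n h σ c 0 - cc 0)
  · refine Or.inl (hPT ((mem_Win G _).2 ⟨graphBall_mono G _ (by omega) hcw, xParkC_self_mem_core_succ_of_far hP cc hcI hfar⟩))
  · refine Or.inr ?_
    obtain ⟨Qt, Ft, hFT, hQD, hlt⟩ := routeSetsW (ψ := runX φ c₀ n h σ) h ℓ hcw hr hrR (coe_pgSideHalfW_subset (G := G) (φ := φ) c n h ℓ Rl σ _)
      (fun w hw => xParkC_mem_region_of_link hP cc hn c₀ hσ hcI hw) (fun w hw => xParkC_mem_core_succ_of_piece hP cc hn c₀ hσ hcI hfar hw)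
      hPD hPT hWD (hlong c _ ((xParkPrmW n ℓ h R' ρ aLo0 A Wm Wp N).steer_eq_or k _))
    exact ⟨Qt, Ft, hFT, hQD, hlt.le⟩

/-- (Habitat law.) **Per-centre input, along-parking level**: a FAR centre is parked (`c ∈ T`), a striding centre carries the route datum from the long x-link of
its steered side half. [cite: KozmaNitzan2024, §4 Lemma 10 Step IV, Lemma 12 (pp. 23–25)] [cite: MartineauTassion2017, §4.3 Lemma 4.2] -/
theorem hroute_xParkCIn (hn : 1 ≤ n) (c₀ : V) {σ : ℤ} (hσ : σ = 1 ∨ σ = -1) {k : ℕ} {w₀ : V} {R r Rl : ℕ} (hr : Rl ≤ r) (hrR : r ≤ R)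
    {Dr T : Finset V} (hPD : Win G (runX φ c₀ n h σ) w₀ ((xParkSchedC hP cc).region k) R ⊆ Dr)
    (hPT : Win G (runX φ c₀ n h σ) w₀ ((xParkSchedC hP cc).core (k + 1)) R ⊆ T)
    {Ω : Finset V} (hDrΩ : Dr ⊆ Ω) {q : unitInterval} {Wt : Sym2 V → unitInterval} (hWD : IsSubbox (winGraphIn G Ω) Wt q Dr) (Λc : V → ℕ → Finset V) (kz : ℕ) {δ : ℝ}
    (hlong : ∀ c (τ : ℤ), τ = 1 ∨ τ = -1 → 1 - δ ^ 3 < (bondPercolation G q).real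
      (linkIn (pgramPrism G φ c n h (3 * ℓ) Rl) (Λc c kz) (pgSideHalfW G φ c n h ℓ Rl σ (σ * τ)))) :
    ∀ c : V, runX φ c₀ n h σ c ∈ Finset.Icc ((xParkSchedC hP cc).lo k - (((xParkSchedC hP cc).R' : ℕ) : Site 2))
        ((xParkSchedC hP cc).hi k + (((xParkSchedC hP cc).R' : ℕ) : Site 2)) → c ∈ graphBall G w₀ (R - r) →
      c ∈ T ∨ ∃ Qt Ft : Finset V, Ft ⊆ T ∧ Qt ⊆ Dr ∧ 1 - δ ^ 3 ≤ (prodBernoulli Wt).real (linkIn (↑Qt : Set V) (Λc c kz) Ft) := by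
  intro c hcI hcw
  by_cases hfar : (xParkPrmW n ℓ h R' ρ aLo0 A Wm Wp N).IsFar k (runX φ c₀ n h σ c 0 - cc 0)
  · refine Or.inl (hPT ((mem_Win G _).2 ⟨graphBall_mono G _ (by omega) hcw, xParkC_self_mem_core_succ_of_far hP cc hcI hfar⟩))
  · refine Or.inr ?_
    obtain ⟨Qt, Ft, hFT, hQD, hlt⟩ := routeSetsWIn (ψ := runX φ c₀ n h σ) h ℓ hcw hr hrR (coe_pgSideHalfW_subset (G := G) (φ := φ) c n h ℓ Rl σ _)
      (fun w hw => xParkC_mem_region_of_link hP cc hn c₀ hσ hcI hw) (fun w hw => xParkC_mem_core_succ_of_piece hP cc hn c₀ hσ hcI hfar hw)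
      hPD hPT hDrΩ hWD (hlong c _ ((xParkPrmW n ℓ h R' ρ aLo0 A Wm Wp N).steer_eq_or k _))
    exact ⟨Qt, Ft, hFT, hQD, hlt.le⟩

end XParkC

/-! ## §3 The across-parking phase (top pieces) -/

section YParkC

variable {n ℓ : ℕ} {h v : ℤ} {R' ρ : ℕ} {aLo0 A : ℤ} {Wm Wp N : ℕ} (hP : ParkOK (yParkPrmW n ℓ h v R' ρ aLo0 A Wm Wp N)) (cc : Site 2)

/-- **A far centre's own frame image lies in the next core** (across-parking). [cite: KozmaNitzan2024, §4 Lemma 12] -/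
theorem yParkC_self_mem_core_succ_of_far {k : ℕ} {y : Site 2}
    (hy : y ∈ Finset.Icc ((yParkSchedC hP cc).lo k - (((yParkSchedC hP cc).R' : ℕ) : Site 2)) ((yParkSchedC hP cc).hi k + (((yParkSchedC hP cc).R' : ℕ) : Site 2)))
    (hfar : (yParkPrmW n ℓ h v R' ρ aLo0 A Wm Wp N).IsFar k (y 1 - cc 1)) : y ∈ (yParkSchedC hP cc).core (k + 1) := by
  have hy' := (mem_yParkC_enl_iff hP cc).1 hy
  refine (mem_yParkC_core_iff hP cc).2 (ParkPrm.box_subset_of_isFar hy' hfar ?_ ?_) <;> simp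

/-- **Per-centre input, across-parking level**: a FAR centre (along coordinate `1`) is parked, a striding centre carries the route datum from the long
y′-link of its steered TOP piece `pgTopPieceW … σ τₖ v` (`τₖ = steer k (runX c 0 − cc 0)`). [cite: KozmaNitzan2024, §4 Lemma 10 Step IV, Lemma 12] -/
theorem hroute_yParkC (hn : 1 ≤ n) (c₀ : V) {σ : ℤ} (hσ : σ = 1 ∨ σ = -1) {k : ℕ} {w₀ : V} {R r Rl : ℕ} (hr : Rl ≤ r) (hrR : r ≤ R)
    {Dr T : Finset V} (hPD : Win G (runX φ c₀ n h σ) w₀ ((yParkSchedC hP cc).region k) R ⊆ Dr)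
    (hPT : Win G (runX φ c₀ n h σ) w₀ ((yParkSchedC hP cc).core (k + 1)) R ⊆ T)
    {q : unitInterval} {Wt : Sym2 V → unitInterval} (hWD : IsSubbox (winGraph G w₀ R) Wt q Dr) (Λc : V → ℕ → Finset V) (kz : ℕ) {δ : ℝ}
    (hlongY : ∀ c (τ : ℤ), τ = 1 ∨ τ = -1 → 1 - δ ^ 3 < (bondPercolation G q).real
      (linkIn (pgramPrism G φ c n h (3 * ℓ) Rl) (Λc c kz) (pgTopPieceW G φ c n h ℓ Rl σ τ v))) :
    ∀ c : V, runX φ c₀ n h σ c ∈ Finset.Icc ((yParkSchedC hP cc).lo k - (((yParkSchedC hP cc).R' : ℕ) : Site 2))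
        ((yParkSchedC hP cc).hi k + (((yParkSchedC hP cc).R' : ℕ) : Site 2)) → c ∈ graphBall G w₀ (R - r) →
      c ∈ T ∨ ∃ Qt Ft : Finset V, Ft ⊆ T ∧ Qt ⊆ Dr ∧ 1 - δ ^ 3 ≤ (prodBernoulli Wt).real (linkIn (↑Qt : Set V) (Λc c kz) Ft) := by
  intro c hcI hcw
  by_cases hfar : (yParkPrmW n ℓ h v R' ρ aLo0 A Wm Wp N).IsFar k (runX φ c₀ n h σ c 1 - cc 1)
  · refine Or.inl (hPT ((mem_Win G _).2 ⟨graphBall_mono G _ (by omega) hcw, yParkC_self_mem_core_succ_of_far hP cc hcI hfar⟩))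
  · refine Or.inr ?_
    obtain ⟨Qt, Ft, hFT, hQD, hlt⟩ := routeSetsW (ψ := runX φ c₀ n h σ) h ℓ hcw hr hrR (coe_pgTopPieceW_subset (G := G) (φ := φ) c n h ℓ Rl σ _ v)
      (fun w hw => yParkC_mem_region_of_link hP cc hn c₀ hσ hcI hw) (fun w hw => yParkC_mem_core_succ_of_piece hP cc hn c₀ hσ hcI hfar hw)
      hPD hPT hWD (hlongY c _ ((yParkPrmW n ℓ h v R' ρ aLo0 A Wm Wp N).steer_eq_or k _))
    exact ⟨Qt, Ft, hFT, hQD, hlt.le⟩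

/-- (Habitat law.) **Per-centre input, across-parking level**: a FAR centre (along coordinate `1`) is parked, a striding centre carries the route datum from the long
y′-link of its steered TOP piece `pgTopPieceW … σ τₖ v` (`τₖ = steer k (runX c 0 − cc 0)`). [cite: KozmaNitzan2024, §4 Lemma 10 Step IV, Lemma 12] -/
theorem hroute_yParkCIn (hn : 1 ≤ n) (c₀ : V) {σ : ℤ} (hσ : σ = 1 ∨ σ = -1) {k : ℕ} {w₀ : V} {R r Rl : ℕ} (hr : Rl ≤ r) (hrR : r ≤ R)
    {Dr T : Finset V} (hPD : Win G (runX φ c₀ n h σ) w₀ ((yParkSchedC hP cc).region k) R ⊆ Dr)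
    (hPT : Win G (runX φ c₀ n h σ) w₀ ((yParkSchedC hP cc).core (k + 1)) R ⊆ T)
    {Ω : Finset V} (hDrΩ : Dr ⊆ Ω) {q : unitInterval} {Wt : Sym2 V → unitInterval} (hWD : IsSubbox (winGraphIn G Ω) Wt q Dr) (Λc : V → ℕ → Finset V) (kz : ℕ) {δ : ℝ}
    (hlongY : ∀ c (τ : ℤ), τ = 1 ∨ τ = -1 → 1 - δ ^ 3 < (bondPercolation G q).real
      (linkIn (pgramPrism G φ c n h (3 * ℓ) Rl) (Λc c kz) (pgTopPieceW G φ c n h ℓ Rl σ τ v))) :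
    ∀ c : V, runX φ c₀ n h σ c ∈ Finset.Icc ((yParkSchedC hP cc).lo k - (((yParkSchedC hP cc).R' : ℕ) : Site 2))
        ((yParkSchedC hP cc).hi k + (((yParkSchedC hP cc).R' : ℕ) : Site 2)) → c ∈ graphBall G w₀ (R - r) →
      c ∈ T ∨ ∃ Qt Ft : Finset V, Ft ⊆ T ∧ Qt ⊆ Dr ∧ 1 - δ ^ 3 ≤ (prodBernoulli Wt).real (linkIn (↑Qt : Set V) (Λc c kz) Ft) := by
  intro c hcI hcw
  by_cases hfar : (yParkPrmW n ℓ h v R' ρ aLo0 A Wm Wp N).IsFar k (runX φ c₀ n h σ c 1 - cc 1)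
  · refine Or.inl (hPT ((mem_Win G _).2 ⟨graphBall_mono G _ (by omega) hcw, yParkC_self_mem_core_succ_of_far hP cc hcI hfar⟩))
  · refine Or.inr ?_
    obtain ⟨Qt, Ft, hFT, hQD, hlt⟩ := routeSetsWIn (ψ := runX φ c₀ n h σ) h ℓ hcw hr hrR (coe_pgTopPieceW_subset (G := G) (φ := φ) c n h ℓ Rl σ _ v)
      (fun w hw => yParkC_mem_region_of_link hP cc hn c₀ hσ hcI hw) (fun w hw => yParkC_mem_core_succ_of_piece hP cc hn c₀ hσ hcI hfar hw)
      hPD hPT hDrΩ hWD (hlongY c _ ((yParkPrmW n ℓ h v R' ρ aLo0 A Wm Wp N).steer_eq_or k _))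
    exact ⟨Qt, Ft, hFT, hQD, hlt.le⟩

end YParkC

end Skelφ

end Summit.CriticalPhenomena.PercolationContinuityZ3.Theorems.Transplant

end
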